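import Mathlib.MeasureTheory.Constructions.Polish.Basic
import Literature.Probability.RandomPlanarGeometry.ChordalCurveFamilyProofs
import HarnessLib

/-!
# `CurveClass.stopAt F` and `CurveClass.startFrom F` are Borel measurable (closed `F`)

Topic `Probability/RandomPlanarGeometry`; theorems only (no definition, no named fact).

The chordal-family axioms of `ChordalCurveFamily.lean` (`ChordalFamily.IsLocal`,
`IsTargetIndependent`, `IsMarkovExtension`) and the named fact
`IsSLELaw.targetIndependence_six` (`SLESixSplitting.lean`, Lawler–Schramm–Werner (2001) Cor. 2.3)
evaluate laws on the sets `CurveClass.stopAt F ⁻¹' T`, `CurveClass.startFrom F ⁻¹' T` for CLOSED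
`F` and Borel `T`, deliberately without asserting measurability of the surgery maps (design note
of `ChordalCurveFamily`: "nothing silently degenerates to `0 = 0`"). For any law CONSTRUCTED as a
push-forward — the chordal SLE laws `IsSLELaw κ D μ = (∃ Γ, … ∧ μ = P.map Γ)` in the first place —
these sets must be known to be Borel before `Measure.map` can be evaluated on them
(`Measure.map_apply_of_aemeasurable`). This file proves it:

* `Curve.lowerSemicontinuous_hitParam_mk` — on parametrised curves `C([0,1], E)` with the sup
  metric, the first hitting parameter of a closed set is lower semicontinuous (a curve that has not
  met `F` by time `s` keeps a positive distance from `F` on `[0, s]`), hence Borel;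
* `Curve.measurable_stopCM`, `Curve.measurable_startCM` — the parametrised surgeries
  `γ ↦ γ ∘ affineClamp 0 T(γ)`, `γ ↦ γ ∘ affineClamp T(γ) (1 - T(γ))` are Borel;
* `CurveClass.measurable_of_lift` — a self-map of `CurveClass ℂ` that lifts to a Borel self-map
  of `C([0,1], ℂ)` along `CurveClass.mk ∘ Curve.mk` is Borel: preimages of Borel sets and their
  complements are continuous images of Borel subsets of a Polish space, i.e. analytic and
  co-analytic, hence Borel by SUSLIN's theorem (Mathlib
  `MeasureTheory.AnalyticSet.measurableSet_of_compl`);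
* `CurveClass.measurable_stopAt`, `CurveClass.measurable_startFrom` (closed `F`), and the
  corollaries `CurveClass.measurableSet_stopAt_preimage`, `measurableSet_startFrom_preimage`,
  `CurveClass.map_apply_stopAt_preimage` (push-forwards CAN be evaluated on the sets of the axioms).

Adapted (verbatim proofs, Literature cannot import Summit files) from the Summit-side
`Summits/CriticalPhenomena/CardyFormulaZ2/Theorems/CardyRotToConfR2SymmetryUpgrade/Negative/SurgStopAtMeasurable.lean`.
References: M. Aizenman, A. Burchard, Duke Math. J. 99 (1999), §2.1 (the curve space);
A. S. Kechris, *Classical Descriptive Set Theory* (1995), Thm. 14.11 (Suslin).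
-/

noncomputable section

open Set Filter Topology Metric MeasureTheory
open scoped unitInterval

namespace Literature.Probability.RandomPlanarGeometry

/-! ### Lower semicontinuity of the hitting parameter on parametrised curves -/

namespace Curve

variable {E : Type*} [MetricSpace E]

-- adapted from Summits/…/CardyRotToConfR2SymmetryUpgrade/Negative/SurgStopAtMeasurable.lean
/-- A curve all of whose values up to parameter `s` avoid `F` has hitting parameter `≥ s`
(`s ≤ 1`). [folklore] -/
theorem le_hitParam_of_forall_notMem {F : Set E} {γ : Curve E} {s : ℝ} (hs : s ≤ 1)
    (h : ∀ t : I, (t : ℝ) ≤ s → γ t ∉ F) : s ≤ γ.hitParam F := by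
  refine le_csInf ⟨1, γ.one_mem_hitSet F⟩ ?_
  rintro t (⟨ht, hmem⟩ | ht)
  · by_contra hlt
    exact h ⟨t, ht⟩ (not_le.1 hlt).le hmem
  · rw [mem_singleton_iff.1 ht]
    exact hs

/-- **The first hitting parameter of a closed set is lower semicontinuous** on `C([0,1], E)` with
the sup metric. [folklore] -/
theorem lowerSemicontinuous_hitParam_mk {F : Set E} (hF : IsClosed F) :
    LowerSemicontinuous fun γ : C(I, E) => (Curve.mk γ).hitParam F := by
  intro γ₀ s hs
  -- negative thresholds are trivial (`hitParam ≥ 0`)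
  rcases lt_or_ge s 0 with hs0 | hs0
  · exact Filter.Eventually.of_forall fun γ => hs0.trans_le ((Curve.mk γ).hitParam_mem_Icc F).1
  -- `0 ≤ s < T₀ ≤ 1`; pick `s < s' < T₀`
  set T₀ := (Curve.mk γ₀).hitParam F with hT₀
  have hT₀1 : T₀ ≤ 1 := ((Curve.mk γ₀).hitParam_mem_Icc F).2
  obtain ⟨s', hss', hs'T⟩ := exists_between hs
  rcases F.eq_empty_or_nonempty with rfl | hFne
  · -- empty set: `hitParam = 1` everywhere
    refine Filter.Eventually.of_forall fun γ => ?_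
    have : (Curve.mk γ).hitParam (∅ : Set E) = 1 :=
      Curve.hitParam_eq_one_of_forall_notMem fun t => Set.notMem_empty _
    show s < (Curve.mk γ).hitParam (∅ : Set E)
    rw [this]
    exact hs.trans_le hT₀1
  -- compact initial piece `K = γ₀ '' {t ≤ s'}` is disjoint from `F`, at positive distance
  have hKc : IsCompact (γ₀ '' {t : I | (t : ℝ) ≤ s'}) :=
    ((isClosed_le continuous_subtype_val continuous_const).isCompact).image γ₀.continuous
  set K : Set E := γ₀ '' {t : I | (t : ℝ) ≤ s'} with hK
  have hKF : ∀ x ∈ K, 0 < infDist x F := by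
    rintro _ ⟨t, ht, rfl⟩
    rw [← hF.notMem_iff_infDist_pos hFne]
    exact Curve.notMem_of_lt_hitParam (ht.trans_lt hs'T)
  -- positive lower bound `δ` of `infDist · F` on `K` (`K` contains `γ₀ 0`)
  have hKne : K.Nonempty := ⟨γ₀ 0, 0, show ((0 : I) : ℝ) ≤ s' by
    simp only [Set.Icc.coe_zero]; linarith, rfl⟩
  obtain ⟨x₀, hx₀K, hx₀min⟩ :=
    hKc.exists_isMinOn hKne (continuous_infDist_pt F).continuousOn
  set δ := infDist x₀ F with hδ
  have hδpos : 0 < δ := hKF x₀ hx₀K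
  -- curves within sup distance `δ` of `γ₀` avoid `F` up to time `s'`
  have key : ∀ γ : C(I, E), dist γ γ₀ < δ → s' ≤ (Curve.mk γ).hitParam F := by
    intro γ hγ
    refine le_hitParam_of_forall_notMem (hs'T.le.trans hT₀1) fun t ht hmem => ?_
    have h1 : δ ≤ infDist (γ₀ t) F := hx₀min (mem_image_of_mem _ ht)
    have h2 : infDist (γ₀ t) F ≤ dist (γ₀ t) (γ t) := infDist_le_dist_of_mem hmem
    have h3 : dist (γ₀ t) (γ t) < δ := by
      rw [dist_comm]
      exact (ContinuousMap.dist_apply_le_dist t).trans_lt hγ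
    linarith
  filter_upwards [Metric.ball_mem_nhds γ₀ hδpos] with γ hγ
  exact hss'.trans_le (key γ (mem_ball.1 hγ))

/-- The hitting parameter is a Borel function on `C([0,1], E)`. [folklore] -/
theorem measurable_hitParam_mk [MeasurableSpace C(I, E)] [OpensMeasurableSpace C(I, E)]
    {F : Set E} (hF : IsClosed F) : Measurable fun γ : C(I, E) => (Curve.mk γ).hitParam F :=
  (lowerSemicontinuous_hitParam_mk hF).measurable

/-- `T ↦ affineClamp a(T) b(T)` is continuous into `C([0,1],[0,1])` for continuous `a`, `b`.
[folklore] -/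
theorem continuous_affineClamp {a b : ℝ → ℝ} (ha : Continuous a) (hb : Continuous b) :
    Continuous fun T : ℝ => Curve.affineClamp (a T) (b T) := by
  let G : C(ℝ × I, I) :=
    ⟨fun p => Set.projIcc 0 1 zero_le_one (a p.1 + b p.1 * p.2),
      continuous_projIcc.comp ((ha.comp continuous_fst).add
        ((hb.comp continuous_fst).mul (continuous_subtype_val.comp continuous_snd)))⟩
  have : (fun T : ℝ => Curve.affineClamp (a T) (b T)) = fun T => G.curry T := by
    funext T
    ext s
    rfl
  rw [this]
  exact G.curry.continuous

/-- The parametrised STOP surgery `γ ↦ γ ∘ affineClamp 0 (hitParam F γ)` is Borel on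
`C([0,1], E)`. [folklore] -/
theorem measurable_stopCM [MeasurableSpace C(I, E)] [BorelSpace C(I, E)] {F : Set E}
    (hF : IsClosed F) :
    Measurable fun γ : C(I, E) => γ.comp (Curve.affineClamp 0 ((Curve.mk γ).hitParam F)) := by
  have hc : Continuous fun p : C(I, E) × ℝ => p.1.comp (Curve.affineClamp 0 p.2) :=
    ContinuousMap.continuous_comp'.comp
      ((continuous_affineClamp continuous_const continuous_id).comp continuous_snd |>.prodMk
        continuous_fst)
  exact hc.measurable.comp (measurable_id.prodMk (measurable_hitParam_mk hF))

/-- The parametrised START surgery `γ ↦ γ ∘ affineClamp T (1 - T)`, `T = hitParam F γ`, is Borel.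
[folklore] -/
theorem measurable_startCM [MeasurableSpace C(I, E)] [BorelSpace C(I, E)] {F : Set E}
    (hF : IsClosed F) :
    Measurable fun γ : C(I, E) =>
      γ.comp (Curve.affineClamp ((Curve.mk γ).hitParam F) (1 - (Curve.mk γ).hitParam F)) := by
  have hc : Continuous fun p : C(I, E) × ℝ => p.1.comp (Curve.affineClamp p.2 (1 - p.2)) :=
    ContinuousMap.continuous_comp'.comp
      ((continuous_affineClamp continuous_id (continuous_const.sub continuous_id)).comp
        continuous_snd |>.prodMk continuous_fst)
  exact hc.measurable.comp (measurable_id.prodMk (measurable_hitParam_mk hF))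

end Curve

/-! ### From parametrised curves to classes: Suslin -/

namespace CurveClass

/-- `CurveClass.mk ∘ Curve.mk : C([0,1], ℂ) → CurveClass ℂ` is surjective. [folklore] -/
theorem surjective_mk_comp_mk :
    Function.Surjective (fun γ : C(I, ℂ) => CurveClass.mk (Curve.mk γ)) := fun c => by
  obtain ⟨γ, rfl⟩ := CurveClass.surjective_mk c
  exact ⟨γ.toContinuousMap, rfl⟩

/-- `CurveClass.mk ∘ Curve.mk` is continuous from the sup distance. [folklore] -/
theorem continuous_mk_comp_mk : Continuous (fun γ : C(I, ℂ) => CurveClass.mk (Curve.mk γ)) :=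
  CurveClass.continuous_mk.comp Curve.lipschitzWith_mk.continuous

-- adapted from Summits/…/CardyRotToConfR2SymmetryUpgrade/Negative/SurgStopAtMeasurable.lean
/-- **A self-map of curve classes that lifts to a Borel self-map of parametrised curves is
Borel** (Suslin: its preimages of Borel sets and their complements are analytic, as continuous
images of Borel subsets of the Polish space `C([0,1], ℂ)`). [folklore] -/
theorem measurable_of_lift
    {g : CurveClass ℂ → CurveClass ℂ} {ĝ : C(I, ℂ) → C(I, ℂ)}
    (hĝ : ∀ [MeasurableSpace C(I, ℂ)] [BorelSpace C(I, ℂ)], Measurable ĝ)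
    (h : ∀ γ : C(I, ℂ), g (CurveClass.mk (Curve.mk γ)) = CurveClass.mk (Curve.mk (ĝ γ))) :
    Measurable g := by
  letI : MeasurableSpace C(I, ℂ) := borel _
  haveI : BorelSpace C(I, ℂ) := ⟨rfl⟩
  set π : C(I, ℂ) → CurveClass ℂ := fun γ => CurveClass.mk (Curve.mk γ) with hπdef
  have hπ : Measurable π := continuous_mk_comp_mk.measurable
  have himage : ∀ A : Set (CurveClass ℂ), g ⁻¹' A = π '' (ĝ ⁻¹' (π ⁻¹' A)) := by
    intro A
    ext c
    constructor
    · intro hc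
      obtain ⟨γ, rfl⟩ := surjective_mk_comp_mk c
      refine ⟨γ, ?_, rfl⟩
      show CurveClass.mk (Curve.mk (ĝ γ)) ∈ A
      rw [← h]
      exact hc
    · rintro ⟨γ, hγ, rfl⟩
      show g (CurveClass.mk (Curve.mk γ)) ∈ A
      rw [h]
      exact hγ
  intro A hA
  refine AnalyticSet.measurableSet_of_compl ?_ ?_
  · rw [himage]
    exact ((hA.preimage hπ).preimage hĝ).analyticSet_image hπ
  · rw [← Set.preimage_compl, himage]
    exact ((hA.compl.preimage hπ).preimage hĝ).analyticSet_image hπ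

/-- **`CurveClass.stopAt F` is Borel measurable for closed `F`** (the lift is the parametrised
stop surgery, by representative independence `CurveClass.stopAt_mk_holds`). [folklore] -/
theorem measurable_stopAt {F : Set ℂ} (hF : IsClosed F) :
    Measurable (CurveClass.stopAt F : CurveClass ℂ → CurveClass ℂ) := by
  refine measurable_of_lift (ĝ := fun γ : C(I, ℂ) =>
    γ.comp (Curve.affineClamp 0 ((Curve.mk γ).hitParam F)))
    (fun {_ _} => Curve.measurable_stopCM hF) fun γ => ?_
  rw [CurveClass.stopAt_mk_holds F hF]
  rfl

/-- **`CurveClass.startFrom F` is Borel measurable for closed `F`.** [folklore] -/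
theorem measurable_startFrom {F : Set ℂ} (hF : IsClosed F) :
    Measurable (CurveClass.startFrom F : CurveClass ℂ → CurveClass ℂ) := by
  refine measurable_of_lift (ĝ := fun γ : C(I, ℂ) =>
    γ.comp (Curve.affineClamp ((Curve.mk γ).hitParam F) (1 - (Curve.mk γ).hitParam F)))
    (fun {_ _} => Curve.measurable_startCM hF) fun γ => ?_
  rw [CurveClass.startFrom_mk_holds F hF]
  rfl

/-- The sets of the locality / target-independence axioms are measurable: for closed `F` and
Borel `T`, `stopAt F ⁻¹' T` is Borel. [folklore] -/
theorem measurableSet_stopAt_preimage {F : Set ℂ} (hF : IsClosed F) {T : Set (CurveClass ℂ)}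
    (hT : MeasurableSet T) : MeasurableSet (CurveClass.stopAt F ⁻¹' T) :=
  hT.preimage (measurable_stopAt hF)

/-- The sets of the Markov axiom are measurable: for closed `F` and Borel `T`,
`startFrom F ⁻¹' T` is Borel. [folklore] -/
theorem measurableSet_startFrom_preimage {F : Set ℂ} (hF : IsClosed F)
    {T : Set (CurveClass ℂ)} (hT : MeasurableSet T) :
    MeasurableSet (CurveClass.startFrom F ⁻¹' T) :=
  hT.preimage (measurable_startFrom hF)

/-- **Push-forwards can be evaluated on the sets of the axioms**: for an a.e.-measurable map
`f` into curve classes, `(μ.map f) (stopAt F ⁻¹' T) = μ (f ⁻¹' (stopAt F ⁻¹' T))`. [folklore] -/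
theorem map_apply_stopAt_preimage {α : Type*} [MeasurableSpace α] {μ : Measure α}
    {f : α → CurveClass ℂ} (hf : AEMeasurable f μ) {F : Set ℂ} (hF : IsClosed F)
    {T : Set (CurveClass ℂ)} (hT : MeasurableSet T) :
    μ.map f (CurveClass.stopAt F ⁻¹' T) = μ (f ⁻¹' (CurveClass.stopAt F ⁻¹' T)) :=
  Measure.map_apply_of_aemeasurable hf (measurableSet_stopAt_preimage hF hT)

end CurveClass

end Literature.Probability.RandomPlanarGeometry

end
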